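import Summits.QuantumFields.YangMills.Theorems.BalabanUVNodesK0RecordFormatNamesFluctB

/-!
# K0⁷ — EDITION 15c: `Δ^{(k)}` BY [I]'s OWN CONSTRUCTION (2.10)–(2.11) — CRIT-1 g34's recommended cure (nodeO STATUS 2026-08-31T02:02:33Z), representative-free

DEFINER seat `ym-nodeO-def-1` (gen 34).  CRIT-1: «define Δ^{(k)} BY [I]'s OWN CONSTRUCTION (2.10)–(2.11) p.267, not by the [13]-split: with `f Vk x := wilsonAction4 (UkSel … (pert … Vk x))`
(gauge-INVARIANT, hence independent of the rooted choice) set `recordΔk Vk := D²f(0) − 2•((Df(0)) ∘ hop-lin ∘ recordC2 Vk) + 2•recordG₂ Vk` … then `recordS∕recordPrec∕recordZk∕recordLogZk` over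
`recordΔk` on `fluctKer`; (1.5)∕(3.156) «`recordΔk = recordQuadDataJ.form` in print's gauge» becomes the THEOREM it is in print, for a porter, later».  THIS FILE names exactly that (the `k`-suffixed
family), `hopLin` (print's `h`) the one displayed parameter.  Polar normalisation: `recordΔk … B₁ B₂` = `D²f(0)(B₁,B₂) − 2·Df(0)(h(C₂(B₁,B₂))) + 2·D²G(0)(B₁,B₂)` with `recordC2 = ½·D²Q̃(0)` and
`recordG₂ = D²G(0)`; the porter's (T2) fixes the overall constant against print's `½⟨B′, Δ^{(k)}B′⟩` (SAID).  `--kind definition --supports stmt-QuantumFields-20541 --as helper`; count-neutral.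

HONEST FRAMING.  Definitions only; nothing of Bałaban asserted, ported or discharged; positivity on `fluctKer`, (2.12) and (1.5) = (3.156) are THEOREMS not asserted; 27930⁸ OPEN; K0⁷∕K-Ax OPEN;
NODE O 0∕1; COUNT 8∕28 · K 1∕4 UNMOVED; finite `𝕋⁴_{L^K}` at fixed ε — NOT continuum ∕ ℝ⁴ ∕ OS; **the Yang–Mills mass gap (Clay) is NOT proved by any of this.**  No `sorry`, `instance`, `notation`.
-/

noncomputable section

open scoped BigOperators Matrix.Norms.L2Operator

namespace Summit.QuantumFields.YangMills.Theorems.K0RecordFormatNames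

open Literature.MathematicalPhysics.QuantumFieldTheory.Balaban1983to89
open Literature.MathematicalPhysics.QuantumFieldTheory.Balaban1983to89.Node00
open Literature.MathematicalPhysics.QuantumFieldTheory.Balaban1983to89.T4Continuum (T4Family)
open _root_.Matrix

variable (F : T4Family)

/-- **`f(B′) = A(U_k(V′V^{(k)}))`** — the Wilson action of the fine minimiser of the perturbed configuration ((2.6) p.267); GAUGE-INVARIANT in the minimiser's representative, hence
independent of the rooted selector's choice inside `UkSel` (the VALUE `A(U_k(·))` is orbit-constant). [cite: Balaban1987RG1, (2.6) p.267, (2.10)–(2.11) p.267] -/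
def recordAUk (k K : ℕ) (εbg : ℝ) (Vk : GaugeField (F.P K) k (SU 2)) (x : FluctIdx F k K → ℝ) : ℝ :=
  wilsonAction4 (UkSel F 2 K k εbg (pert F k K Vk x))

/-- `Df(0)` — the first derivative of `A ∘ U_k ∘ pert` at `B′ = 0`. [cite: Balaban1987RG1, (2.7) p.267] -/
def recordDAUk (k K : ℕ) (εbg : ℝ) (Vk : GaugeField (F.P K) k (SU 2)) : (FluctIdx F k K → ℝ) →L[ℝ] ℝ :=
  fderiv ℝ (recordAUk F k K εbg Vk) 0

/-- `D²f(0)` — the second derivative of `A ∘ U_k ∘ pert` at `B′ = 0`. [cite: Balaban1987RG1, (2.8) p.267] -/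
def recordD2AUk (k K : ℕ) (εbg : ℝ) (Vk : GaugeField (F.P K) k (SU 2)) : (FluctIdx F k K → ℝ) →L[ℝ] (FluctIdx F k K → ℝ) →L[ℝ] ℝ :=
  fderiv ℝ (fun x => fderiv ℝ (recordAUk F k K εbg Vk) x) 0

/-- ★ **`Δ^{(k)}(V^{(k)})` BY (2.10)–(2.11)** — the order-`g_k⁰` quadratic part of the exponent after `B′ ↦ B′ − hD̃(B′)` and the scaling, REPRESENTATIVE-FREE:
`D²f(0) − 2·Df(0) ∘ h ∘ C₂ + 2·D²G(0)` (polar form; `h = hopLin` displayed). [cite: Balaban1987RG1, (2.10)–(2.11) p.267, (1.5) p.261] -/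
def recordΔk (k K : ℕ) (εbg : ℝ) (Vk : GaugeField (F.P K) k (SU 2)) (hopLin : (PBond (F.P K) (k + 1) → MatA 2) →ₗ[ℝ] (FluctIdx F k K → ℝ)) :
    (FluctIdx F k K → ℝ) →ₗ[ℝ] (FluctIdx F k K → ℝ) →ₗ[ℝ] ℝ :=
  bilinOf (recordD2AUk F k K εbg Vk)
    - (2 : ℝ) • (bilinOf (recordC2 F k K Vk)).compr₂ ((recordDAUk F k K εbg Vk).toLinearMap ∘ₗ hopLin)
    + (2 : ℝ) • bilinOf (recordG₂ F k K Vk)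

/-- **The matrix of `Δ^{(k)}`** in the B′-coordinates. [cite: Balaban1987RG1, (1.4) p.260, (2.11) p.267] -/
def recordSk (k K : ℕ) (εbg : ℝ) (Vk : GaugeField (F.P K) k (SU 2)) (hopLin : (PBond (F.P K) (k + 1) → MatA 2) →ₗ[ℝ] (FluctIdx F k K → ℝ)) :
    Matrix (FluctIdx F k K) (FluctIdx F k K) ℝ :=
  LinearMap.toMatrix₂' ℝ (recordΔk F k K εbg Vk hopLin)

/-- **`Cᵀ Δ^{(k)} C` on the linearised constraint surface** (p.268 «C^{(k)}(U_{k+1}) = (C*Δ^{(k)}C)⁻¹») — the `T` of `B10LogDet63.matrix63`; positivity NOT asserted.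
[cite: Balaban1987RG1, p.268] -/
def recordPreck (k K : ℕ) (εbg : ℝ) (Vk : GaugeField (F.P K) k (SU 2)) (hopLin : (PBond (F.P K) (k + 1) → MatA 2) →ₗ[ℝ] (FluctIdx F k K → ℝ)) :
    Matrix (Fin (Module.finrank ℝ (fluctKer F k K Vk))) (Fin (Module.finrank ℝ (fluctKer F k K Vk))) ℝ :=
  (recordCop F k K Vk)ᵀ * recordSk F k K εbg Vk hopLin * recordCop F k K Vk

/-- **`Z^{(k)}`** by (1.4) over `recordΔk`. [cite: Balaban1987RG1, (1.4) p.260] -/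
def recordZkk (k K : ℕ) (εbg : ℝ) (Vk : GaugeField (F.P K) k (SU 2)) (hopLin : (PBond (F.P K) (k + 1) → MatA 2) →ₗ[ℝ] (FluctIdx F k K → ℝ)) : ℝ :=
  B12Eq15QuadraticForm.Z14 (recordSk F k K εbg Vk hopLin) (recordCop F k K Vk)

/-- **`log Z^{(k)}`** over `recordΔk` (D-defB-2's slot, representative-free). [cite: Balaban1987RG1, (1.3)–(1.4) p.260] -/
def recordLogZkk (k K : ℕ) (εbg : ℝ) (Vk : GaugeField (F.P K) k (SU 2)) (hopLin : (PBond (F.P K) (k + 1) → MatA 2) →ₗ[ℝ] (FluctIdx F k K → ℝ)) : ℝ :=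
  Real.log (recordZkk F k K εbg Vk hopLin)

/-! ## DEPRECATION (v2, CRIT-1 g34 custody 02:11:55Z) — `recordΔk ∕ recordSk ∕ recordPreck ∕ recordZkk ∕ recordLogZkk` (v1, p802604) carry the coefficient `2` on
`bilinOf recordG₂`, which is WRONG: by (2.1) p.265 (𝐆 and A carry the SAME `1∕g_k²`), (2.5) p.266 «G(V′V^{(k)}) = ½G^{(2)}(B′) + G₃(B′)» (tree `B12GaugeFixExpansion25Holo`:
`G^{(2)}(B′) = D²G(0)(B′,B′) = recordG₂`) and (2.11) p.267 «−½⟨B, Δ^{(k)}B⟩», `⟨B, Δ^{(k)}B⟩ = D²g(0)(B,B) + G^{(2)}(B)` with `g := f ∘ (id − h∘D̃)` — coefficient ONE.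
The gate forbids in-place mutation of a landed body, so the corrected objects are the `…₁` twins below; the v1 names are DEPRECATED (consumed by nothing of record; ▶ PTA-1's
provisional key `T := recordPreck` moves to `recordPreck₁`).  Z-NORMALISATION LETTER (CRIT-1 02:19:22Z ∕ PTA-1 `Z-NORMALISATION-v1.md`): `recordZkk₁ ∕ recordLogZkk₁ ∕ recordPreck₁`
are ARBITRARY-BASIS VARIANTS (the columns `recordCop` are a `Module.finBasis` choice, fixing `Z14` only up to `|det A(Vk)|⁻¹`); print's (1.4) `Z^{(k)}` is the canonical twin
`recordZkkCan` (ed.15d). -/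

/-- ★ **`Δ^{(k)}(V^{(k)})` BY (2.10)–(2.11), CORRECTED (v2)** — `D²f(0) − 2·Df(0) ∘ h ∘ C₂ + D²G(0)` (polar form; coefficient ONE on `G^{(2)} = D²G(0) = recordG₂` per
(2.1)∕(2.5)∕(2.11); `h = hopLin` displayed); supersedes the deprecated `recordΔk`. [cite: Balaban1987RG1, (2.10)–(2.11) p.267, (2.1) p.265, (2.5) p.266, (1.5) p.261] -/
def recordΔk₁ (k K : ℕ) (εbg : ℝ) (Vk : GaugeField (F.P K) k (SU 2)) (hopLin : (PBond (F.P K) (k + 1) → MatA 2) →ₗ[ℝ] (FluctIdx F k K → ℝ)) :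
    (FluctIdx F k K → ℝ) →ₗ[ℝ] (FluctIdx F k K → ℝ) →ₗ[ℝ] ℝ :=
  bilinOf (recordD2AUk F k K εbg Vk)
    - (2 : ℝ) • (bilinOf (recordC2 F k K Vk)).compr₂ ((recordDAUk F k K εbg Vk).toLinearMap ∘ₗ hopLin)
    + bilinOf (recordG₂ F k K Vk)

/-- **The matrix of the corrected `Δ^{(k)}`** in the B′-coordinates; supersedes `recordSk`. [cite: Balaban1987RG1, (1.4) p.260, (2.11) p.267] -/
def recordSk₁ (k K : ℕ) (εbg : ℝ) (Vk : GaugeField (F.P K) k (SU 2)) (hopLin : (PBond (F.P K) (k + 1) → MatA 2) →ₗ[ℝ] (FluctIdx F k K → ℝ)) :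
    Matrix (FluctIdx F k K) (FluctIdx F k K) ℝ :=
  LinearMap.toMatrix₂' ℝ (recordΔk₁ F k K εbg Vk hopLin)

/-- **`Cᵀ Δ^{(k)} C` (corrected) on the linearised constraint surface** in the ARBITRARY basis `recordCop` — the `T` of `B10LogDet63.matrix63`; positivity NOT asserted;
supersedes `recordPreck`. [cite: Balaban1987RG1, p.268] -/
def recordPreck₁ (k K : ℕ) (εbg : ℝ) (Vk : GaugeField (F.P K) k (SU 2)) (hopLin : (PBond (F.P K) (k + 1) → MatA 2) →ₗ[ℝ] (FluctIdx F k K → ℝ)) :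
    Matrix (Fin (Module.finrank ℝ (fluctKer F k K Vk))) (Fin (Module.finrank ℝ (fluctKer F k K Vk))) ℝ :=
  (recordCop F k K Vk)ᵀ * recordSk₁ F k K εbg Vk hopLin * recordCop F k K Vk

/-- **`Z^{(k)}`-VARIANT (corrected `Δ^{(k)}`)** — (1.4)'s Gaussian over `recordΔk₁` in the ARBITRARY basis `recordCop` (fixed up to `|det A(Vk)|⁻¹`; print's (1.4) is the
canonical twin `recordZkkCan`, ed.15d); supersedes `recordZkk`. [cite: Balaban1987RG1, (1.4) p.260] -/
def recordZkk₁ (k K : ℕ) (εbg : ℝ) (Vk : GaugeField (F.P K) k (SU 2)) (hopLin : (PBond (F.P K) (k + 1) → MatA 2) →ₗ[ℝ] (FluctIdx F k K → ℝ)) : ℝ :=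
  B12Eq15QuadraticForm.Z14 (recordSk₁ F k K εbg Vk hopLin) (recordCop F k K Vk)

/-- **`log Z^{(k)}`-VARIANT (corrected `Δ^{(k)}`)**, arbitrary basis; supersedes `recordLogZkk`. [cite: Balaban1987RG1, (1.3)–(1.4) p.260] -/
def recordLogZkk₁ (k K : ℕ) (εbg : ℝ) (Vk : GaugeField (F.P K) k (SU 2)) (hopLin : (PBond (F.P K) (k + 1) → MatA 2) →ₗ[ℝ] (FluctIdx F k K → ℝ)) : ℝ :=
  Real.log (recordZkk₁ F k K εbg Vk hopLin)

end Summit.QuantumFields.YangMills.Theorems.K0RecordFormatNames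

end
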